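import Literature.InformationTheory.QuantumCodes.SymplecticConstructions
import Literature.InformationTheory.QuantumCodes.LogicalPauliMap
import HarnessLib

/-!
# The generalized direct sum `[[n₁,k₁,d₁]] ⊕_ρ [[n₂,k₂,d₂]] = [[n₁+n₂−k₂, k₁, ≥ min{d₁, d₁+d₂−k₂}]]`
# (Calderbank–Rains–Shor–Sloane 1998, Theorem 8) — proved

Source (CRSS 1998 §4, printed p. 14; arXiv:quant-ph/9608006 chunk p0015 L15–30): "The direct sum construction used
in Theorem 6(a) can be generalized. **Theorem 8.** Given two codes `[[n₁, k₁, d₁]]` and `[[n₂, k₂, d₂]]` with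
`k₂ ≤ n₁` we can construct an `[[n₁ + n₂ − k₂, k₁, d]]` code, where `d ≥ min{d₁, d₁ + d₂ − k₂}`. *Proof.* … Let
`ρ` be the composition of the natural map from `C₂⊥` to `C₂⊥/C₂` with any inner-product preserving map from
`C₂⊥/C₂` to `GF(4)^{k₂}`. Then we form a new code `C = {uv : v ∈ C₂⊥, uρ(v) ∈ C₁}`, with
`C⊥ = {uv : v ∈ C₂⊥, uρ(v) ∈ C₁⊥}`. If `ρ(v) ≠ 0`, `v` contributes at least `d₂` to the weight of `uv`, but `u`
need have weight only `d₁ − k₂`. If `ρ(v) = 0`, and `uv ≠ 0` [read: `uv ∉ C`], `wt(u) ≥ d₁`. □"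

Formalization (binary symplectic language of `SymplecticCodes.lean`; `n₁ = m + k₂`, the `u`-block has length `m`):
the map `ρ` is `logicalMap x z` of a logical basis `x z` of `S̄₂` (`LogicalPauliMap.lean`: onto `Ē_{k₂}`, kernel
`S̄₂` on `S̄₂⊥`, form-preserving — exactly the three properties the printed proof uses).

* `genDirectSum S₁ S₂ x z ≤ Ē_{m+n₂}` — the code `C = {(u|v) : v ∈ S̄₂⊥, (u|ρv) ∈ S̄₁}`; membership lemmas
  `juxt_mem_genDirectSum_iff`, `mem_genDirectSum_iff`; `genDirectSum_mono`.
* `sympDual_genDirectSum` — **`C⊥ = {(u|v) : v ∈ S̄₂⊥, (u|ρv) ∈ S̄₁⊥}`** (`= genDirectSum (S̄₁⊥) S̄₂ x z`), PROVED;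
  hence `isSelfOrthogonal_genDirectSum`.
* `finrank_genDirectSum` — `dim C = dim S̄₁ + dim S̄₂` (via `C ≅ (0 ⊕ S̄₂) ⊕ Λ(S̄₁)`, `Λ(a|b) = (a, lift b)`), so the
  new code has `k = (m + n₂) − (m + k₂ − k₁) − (n₂ − k₂) = k₁` logical qubits.
* `CRSS1998_theorem8` — for an `[[m+k₂, k₁, d₁]]` code `S̄₁`, an `[[n₂, k₂, d₂]]` code `S̄₂` with logical basis
  `x z` and `0 < k₁`: `IsAdditiveCode (genDirectSum S₁ S₂ x z) k₁ (min d₁ (d₁ − k₂ + d₂))` (truncated subtraction;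
  this is `≥` the printed `min{d₁, d₁ + d₂ − k₂}`), and the existence form `AdditiveCodeExists.genDirectSum`
  with the printed parameters `[[n₁ + n₂ − k₂, k₁, min{d₁, d₁ + d₂ − k₂}]]`.

We require `0 < k₁`: for `k₁ = 0` the new space is self-dual and the purity convention for `[[n, 0, d]]` in
`IsAdditiveCode` is not implied by the hypotheses (the construction contains `(0|s)` for every `s ∈ S̄₂`, whose
weight is not controlled by `d₁, d₂` when `S̄₂` is impure). All statements are theorems (no named facts).

## References
* [CalderbankEtAl1998] A. R. Calderbank, E. M. Rains, P. W. Shor, N. J. A. Sloane, *Quantum error correction via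
  codes over GF(4)*, IEEE Trans. Inform. Theory 44 (1998) 1369–1387, arXiv:quant-ph/9608006, §4 Thm. 8 (p. 14).
* [Gottesman1997] D. Gottesman, *Stabilizer Codes and Quantum Error Correction*, Caltech Ph.D. thesis (1997),
  arXiv:quant-ph/9705052, §3.2 (the map `N(S)/S → 𝒢_k`).
-/

namespace Literature.InformationTheory.QuantumCodes

open Finset Module

variable {m k₂ n₂ : ℕ}

/-! ### The maps `Φ(u, v) = (u | ρ v)` and `Λ(a | b) = (a, lift b)` -/

/-- `Φ(u, v) = (u | ρ(v)) ∈ Ē_{m+k₂}` for `(u, v) ∈ Ē_m × Ē_{n₂}` (the word `uρ(v)` of the printed proof). Linear.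
[cite: CalderbankEtAl1998, §4 proof of Thm. 8 (printed p. 14: "uρ(v) ∈ C₁")] -/
def rhoJuxt (m : ℕ) (x z : Fin k₂ → SympVec n₂) : (SympVec m × SympVec n₂) →ₗ[ZMod 2] SympVec (m + k₂) :=
  (juxtEquiv m k₂ : (SympVec m × SympVec k₂) →ₗ[ZMod 2] SympVec (m + k₂)) ∘ₗ
    (LinearMap.id.prodMap (logicalMap x z))

/-- `Φ(u, v) = (u | ρ v)`. [cite: CalderbankEtAl1998, §4 proof of Thm. 8 (printed p. 14)] -/
@[simp] theorem rhoJuxt_apply (x z : Fin k₂ → SympVec n₂) (p : SympVec m × SympVec n₂) :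
    rhoJuxt m x z p = juxt p.1 (logicalMap x z p.2) := rfl

/-- `Λ(a | b) = (a, lift b) ∈ Ē_m × Ē_{n₂}`: choose the representative `lift b ∈ S̄₂⊥` of the logical class `b`
("choosing `ρ` corresponds to choosing an encoding method for `C₂`"). Linear.
[cite: CalderbankEtAl1998, §4 Thm. 8 and the remark after it (printed p. 14)] -/
def liftPair (m : ℕ) (x z : Fin k₂ → SympVec n₂) : SympVec (m + k₂) →ₗ[ZMod 2] (SympVec m × SympVec n₂) :=
  (LinearMap.id.prodMap (logicalLift x z)) ∘ₗ
    ((juxtEquiv m k₂).symm : SympVec (m + k₂) →ₗ[ZMod 2] (SympVec m × SympVec k₂))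

/-- `Λ(a | b) = (a, lift b)`. [cite: CalderbankEtAl1998, §4 Thm. 8 (printed p. 14)] -/
theorem liftPair_juxt (x z : Fin k₂ → SympVec n₂) (a : SympVec m) (b : SympVec k₂) :
    liftPair m x z (juxt a b) = (a, logicalLift x z b) := by
  rw [liftPair, LinearMap.comp_apply, LinearEquiv.coe_coe, ← juxtEquiv_apply (p := (a, b)),
    LinearEquiv.symm_apply_apply, LinearMap.prodMap_apply, LinearMap.id_apply]

section Basis

variable {S₁ : Submodule (ZMod 2) (SympVec (m + k₂))} {S₂ : Submodule (ZMod 2) (SympVec n₂)}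
  {x z : Fin k₂ → SympVec n₂}

/-- `lift` is injective (it has the left inverse `ρ`). [cite: Gottesman1997, §3.2 (arXiv:quant-ph/9705052 chunk p0019 L17–27)] -/
theorem logicalLift_injective (h : IsLogicalBasis S₂ x z) : Function.Injective (logicalLift x z) :=
  Function.LeftInverse.injective (g := logicalMap x z) (logicalMap_logicalLift h)

/-- `Λ` is injective. [cite: CalderbankEtAl1998, §4 Thm. 8 (printed p. 14)] -/
theorem liftPair_injective (h : IsLogicalBasis S₂ x z) : Function.Injective (liftPair m x z) := by
  intro t t' htt
  obtain ⟨⟨a, b⟩, rfl⟩ := (juxtEquiv m k₂).surjective t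
  obtain ⟨⟨a', b'⟩, rfl⟩ := (juxtEquiv m k₂).surjective t'
  simp only [juxtEquiv_apply, liftPair_juxt, Prod.mk.injEq] at htt ⊢
  rw [htt.1, logicalLift_injective h htt.2]

end Basis

/-! ### The code `C = {(u|v) : v ∈ S̄₂⊥, (u|ρv) ∈ S̄₁}` -/

/-- The generalized direct sum in pair form: `{(u, v) ∈ Ē_m × Ē_{n₂} : v ∈ S̄₂⊥, (u|ρv) ∈ S̄₁}`.
[cite: CalderbankEtAl1998, §4 proof of Thm. 8 (printed p. 14: "C = {uv : v ∈ C₂⊥, uρ(v) ∈ C₁}")] -/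
def genDirectSumPair (S₁ : Submodule (ZMod 2) (SympVec (m + k₂))) (S₂ : Submodule (ZMod 2) (SympVec n₂))
    (x z : Fin k₂ → SympVec n₂) : Submodule (ZMod 2) (SympVec m × SympVec n₂) :=
  (sympDual S₂).comap (LinearMap.snd (ZMod 2) (SympVec m) (SympVec n₂)) ⊓ S₁.comap (rhoJuxt m x z)

/-- **The generalized direct sum** `C = {(u|v) : v ∈ S̄₂⊥, (u|ρ(v)) ∈ S̄₁} ≤ Ē_{m+n₂}` of an additive code
`S̄₁ ≤ Ē_{m+k₂}` and an additive code `S̄₂ ≤ Ē_{n₂}` with logical basis `x z` (`ρ = logicalMap x z`).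
[cite: CalderbankEtAl1998, §4 Thm. 8 (printed p. 14: "C = {uv : v ∈ C₂⊥, uρ(v) ∈ C₁}")] -/
def genDirectSum (S₁ : Submodule (ZMod 2) (SympVec (m + k₂))) (S₂ : Submodule (ZMod 2) (SympVec n₂))
    (x z : Fin k₂ → SympVec n₂) : Submodule (ZMod 2) (SympVec (m + n₂)) :=
  (genDirectSumPair S₁ S₂ x z).map (juxtEquiv m n₂ : (SympVec m × SympVec n₂) →ₗ[ZMod 2] SympVec (m + n₂))

section Code

variable {S₁ : Submodule (ZMod 2) (SympVec (m + k₂))} {S₂ : Submodule (ZMod 2) (SympVec n₂)}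
  {x z : Fin k₂ → SympVec n₂}

/-- Membership, pair form. [cite: CalderbankEtAl1998, §4 Thm. 8 (printed p. 14)] -/
theorem mem_genDirectSumPair_iff {p : SympVec m × SympVec n₂} :
    p ∈ genDirectSumPair S₁ S₂ x z ↔ p.2 ∈ sympDual S₂ ∧ juxt p.1 (logicalMap x z p.2) ∈ S₁ := by
  rw [genDirectSumPair, Submodule.mem_inf, Submodule.mem_comap, Submodule.mem_comap]; rfl

/-- **Membership**: `(u|v) ∈ C ↔ v ∈ S̄₂⊥ ∧ (u|ρv) ∈ S̄₁`.
[cite: CalderbankEtAl1998, §4 Thm. 8 (printed p. 14: "C = {uv : v ∈ C₂⊥, uρ(v) ∈ C₁}")] -/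
theorem juxt_mem_genDirectSum_iff {u : SympVec m} {v : SympVec n₂} :
    juxt u v ∈ genDirectSum S₁ S₂ x z ↔ v ∈ sympDual S₂ ∧ juxt u (logicalMap x z v) ∈ S₁ := by
  rw [genDirectSum, ← juxtEquiv_apply (p := (u, v)), Submodule.mem_map_equiv, LinearEquiv.symm_apply_apply,
    mem_genDirectSumPair_iff]

/-- Membership, block form. [cite: CalderbankEtAl1998, §4 Thm. 8 (printed p. 14)] -/
theorem mem_genDirectSum_iff {w : SympVec (m + n₂)} :
    w ∈ genDirectSum S₁ S₂ x z ↔ ((juxtEquiv m n₂).symm w).2 ∈ sympDual S₂ ∧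
      juxt ((juxtEquiv m n₂).symm w).1 (logicalMap x z ((juxtEquiv m n₂).symm w).2) ∈ S₁ := by
  rw [genDirectSum, Submodule.mem_map_equiv, mem_genDirectSumPair_iff]

/-- The construction is monotone in `S̄₁`. [cite: CalderbankEtAl1998, §4 Thm. 8 (printed p. 14)] -/
theorem genDirectSum_mono {S₁' : Submodule (ZMod 2) (SympVec (m + k₂))} (hle : S₁ ≤ S₁') :
    genDirectSum S₁ S₂ x z ≤ genDirectSum S₁' S₂ x z := fun w hw => by
  rw [mem_genDirectSum_iff] at hw ⊢
  exact ⟨hw.1, hle hw.2⟩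

/-- The computation behind the printed proof: for `v, v′ ∈ S̄₂⊥`, `((u|v),(u′|v′)) = ((u|ρv),(u′|ρv′))` (the form
splits over the blocks and `ρ` is inner-product preserving).
[cite: CalderbankEtAl1998, §4 proof of Thm. 8 (printed p. 14: "any inner-product preserving map")] -/
theorem sympInner_juxt_eq_sympInner_rhoJuxt (h : IsLogicalBasis S₂ x z) (hS₂ : IsSelfOrthogonal S₂)
    (hk : finrank (ZMod 2) S₂ + k₂ = n₂) (u u' : SympVec m) {v v' : SympVec n₂} (hv : v ∈ sympDual S₂)
    (hv' : v' ∈ sympDual S₂) :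
    sympInner (juxt u v) (juxt u' v') = sympInner (juxt u (logicalMap x z v)) (juxt u' (logicalMap x z v')) := by
  rw [sympInner_juxt, sympInner_juxt, sympInner_logicalMap h hS₂ hk hv hv']

/-- **The dual of the generalized direct sum**: `C⊥ = {(u|v) : v ∈ S̄₂⊥, (u|ρv) ∈ S̄₁⊥}`, i.e. the same
construction applied to `S̄₁⊥`.
[cite: CalderbankEtAl1998, §4 proof of Thm. 8 (printed p. 14: "with C⊥ = {uv : v ∈ C₂⊥, uρ(v) ∈ C₁⊥}")] -/
theorem sympDual_genDirectSum (h : IsLogicalBasis S₂ x z) (hS₂ : IsSelfOrthogonal S₂)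
    (hk : finrank (ZMod 2) S₂ + k₂ = n₂) :
    sympDual (genDirectSum S₁ S₂ x z) = genDirectSum (sympDual S₁) S₂ x z := by
  ext w
  rw [mem_genDirectSum_iff, mem_sympDual_iff]
  have hw : w = juxt ((juxtEquiv m n₂).symm w).1 ((juxtEquiv m n₂).symm w).2 := (juxt_symm_apply w).symm
  constructor
  · intro H
    -- `v ∈ S̄₂⊥`: test against `(0|s)`, `s ∈ S̄₂` (in `C` since `ρ s = 0`)
    have hv : ((juxtEquiv m n₂).symm w).2 ∈ sympDual S₂ := by
      rw [mem_sympDual_iff]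
      intro s hs
      have hρ : logicalMap x z s = 0 := (logicalMap_eq_zero_iff h hS₂ hk (hS₂ hs)).2 hs
      have h0 : juxt (0 : SympVec m) (logicalMap x z s) ∈ S₁ := by
        rw [hρ, (juxt_eq_zero_iff (0 : SympVec m) (0 : SympVec k₂)).2 ⟨rfl, rfl⟩]; exact S₁.zero_mem
      have := H (juxt 0 s) (juxt_mem_genDirectSum_iff.2 ⟨hS₂ hs, h0⟩)
      rwa [hw, sympInner_juxt, sympInner_zero_left, zero_add] at this
    -- `(u|ρv) ∈ S̄₁⊥`: test against `(a | lift b)` for `(a|b) ∈ S̄₁`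
    refine ⟨hv, mem_sympDual_iff.2 fun t ht => ?_⟩
    have ht' : t = juxt ((juxtEquiv m k₂).symm t).1 ((juxtEquiv m k₂).symm t).2 := (juxt_symm_apply t).symm
    have hc : juxt ((juxtEquiv m k₂).symm t).1 (logicalLift x z ((juxtEquiv m k₂).symm t).2) ∈
        genDirectSum S₁ S₂ x z :=
      juxt_mem_genDirectSum_iff.2 ⟨logicalLift_mem_sympDual h _, by rw [logicalMap_logicalLift h, ← ht']; exact ht⟩
    have := H _ hc
    rwa [hw, sympInner_juxt_eq_sympInner_rhoJuxt h hS₂ hk _ _ (logicalLift_mem_sympDual h _) hv,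
      logicalMap_logicalLift h, ← ht'] at this
  · rintro ⟨hv, hu⟩ c hc
    rw [← juxt_symm_apply c] at hc ⊢
    obtain ⟨hv', h1⟩ := juxt_mem_genDirectSum_iff.1 hc
    rw [hw, sympInner_juxt_eq_sympInner_rhoJuxt h hS₂ hk _ _ hv' hv]
    exact mem_sympDual_iff.1 hu _ h1

/-- **`C` is self-orthogonal** when `S̄₁`, `S̄₂` are (`C ≤ C⊥` as `S̄₁ ≤ S̄₁⊥`).
[cite: CalderbankEtAl1998, §4 Thm. 8 (printed p. 14)] -/
theorem isSelfOrthogonal_genDirectSum (hS₁ : IsSelfOrthogonal S₁) (h : IsLogicalBasis S₂ x z)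
    (hS₂ : IsSelfOrthogonal S₂) (hk : finrank (ZMod 2) S₂ + k₂ = n₂) :
    IsSelfOrthogonal (genDirectSum S₁ S₂ x z) := by
  unfold IsSelfOrthogonal
  rw [sympDual_genDirectSum h hS₂ hk]
  exact genDirectSum_mono hS₁

/-! ### Dimension: `C ≅ (0 ⊕ S̄₂) ⊕ Λ(S̄₁)` -/

/-- `v + v = 0` in `Ē` (characteristic two). [folklore] -/
private theorem add_self_sympVec' (v : SympVec n₂) : v + v = 0 :=
  Prod.ext (funext fun _ => CharTwo.add_self_eq_zero _) (funext fun _ => CharTwo.add_self_eq_zero _)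

/-- **Decomposition** `C = (0 ⊕ S̄₂) + Λ(S̄₁)` (pair form): `(u, v) = (0, v + lift ρv) + (u, lift ρv)` with
`v + lift ρv ∈ S̄₂` and `(u | ρv) ∈ S̄₁`. [cite: CalderbankEtAl1998, §4 Thm. 8 (printed p. 14)] -/
theorem genDirectSumPair_eq_sup (h : IsLogicalBasis S₂ x z) (hS₂ : IsSelfOrthogonal S₂)
    (hk : finrank (ZMod 2) S₂ + k₂ = n₂) :
    genDirectSumPair S₁ S₂ x z =
      S₂.map (LinearMap.inr (ZMod 2) (SympVec m) (SympVec n₂)) ⊔ S₁.map (liftPair m x z) := by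
  refine le_antisymm (fun p hp => ?_) (sup_le (fun p hp => ?_) (fun p hp => ?_))
  · obtain ⟨hv, h1⟩ := mem_genDirectSumPair_iff.1 hp
    have hs : p.2 + logicalLift x z (logicalMap x z p.2) ∈ S₂ := add_logicalLift_logicalMap_mem h hS₂ hk hv
    have hdec : p = LinearMap.inr (ZMod 2) (SympVec m) (SympVec n₂) (p.2 + logicalLift x z (logicalMap x z p.2)) +
        liftPair m x z (juxt p.1 (logicalMap x z p.2)) := by
      rw [liftPair_juxt, LinearMap.inr_apply, Prod.mk_add_mk, zero_add, add_assoc, add_self_sympVec', add_zero]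
    rw [hdec]
    exact Submodule.add_mem _ (Submodule.mem_sup_left (Submodule.mem_map_of_mem hs))
      (Submodule.mem_sup_right (Submodule.mem_map_of_mem h1))
  · obtain ⟨s, hs, rfl⟩ := Submodule.mem_map.1 hp
    rw [mem_genDirectSumPair_iff, LinearMap.inr_apply]
    have hρ : logicalMap x z s = 0 := (logicalMap_eq_zero_iff h hS₂ hk (hS₂ hs)).2 hs
    refine ⟨hS₂ hs, ?_⟩
    show juxt (0 : SympVec m) (logicalMap x z s) ∈ S₁
    rw [hρ, (juxt_eq_zero_iff (0 : SympVec m) (0 : SympVec k₂)).2 ⟨rfl, rfl⟩]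
    exact S₁.zero_mem
  · obtain ⟨t, ht, rfl⟩ := Submodule.mem_map.1 hp
    obtain ⟨⟨a, b⟩, rfl⟩ := (juxtEquiv m k₂).surjective t
    rw [juxtEquiv_apply] at ht ⊢
    rw [liftPair_juxt, mem_genDirectSumPair_iff]
    refine ⟨logicalLift_mem_sympDual h b, ?_⟩
    show juxt a (logicalMap x z (logicalLift x z b)) ∈ S₁
    rwa [logicalMap_logicalLift h]

/-- `(0 ⊕ S̄₂) ∩ Λ(S̄₁) = 0`: if `(0, s) = (a, lift b)` with `s ∈ S̄₂` then `b = ρ(lift b) = ρ(s) = 0`.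
[cite: CalderbankEtAl1998, §4 Thm. 8 (printed p. 14)] -/
theorem map_inr_inf_map_liftPair (h : IsLogicalBasis S₂ x z) (hS₂ : IsSelfOrthogonal S₂)
    (hk : finrank (ZMod 2) S₂ + k₂ = n₂) :
    S₂.map (LinearMap.inr (ZMod 2) (SympVec m) (SympVec n₂)) ⊓ S₁.map (liftPair m x z) = ⊥ := by
  rw [Submodule.eq_bot_iff]
  rintro p ⟨hp₁, hp₂⟩
  obtain ⟨s, hs, rfl⟩ := Submodule.mem_map.1 hp₁
  obtain ⟨t, -, hts⟩ := Submodule.mem_map.1 hp₂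
  obtain ⟨⟨a, b⟩, rfl⟩ := (juxtEquiv m k₂).surjective t
  rw [juxtEquiv_apply, liftPair_juxt, LinearMap.inr_apply, Prod.mk.injEq] at hts
  have hb : b = 0 := by
    rw [← logicalMap_logicalLift h b, hts.2]
    exact (logicalMap_eq_zero_iff h hS₂ hk (hS₂ hs)).2 hs
  have hs0 : s = 0 := by rw [← hts.2, hb, map_zero]
  rw [hs0, map_zero]

/-- **Dimension**: `dim C = dim S̄₁ + dim S̄₂` (so the code has `(n₁ − l₁) + … ` — here
`(m + k₂ − k₁) + (n₂ − k₂)` — generators and encodes `k₁` qubits).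
[cite: CalderbankEtAl1998, §4 Thm. 8 (printed p. 14: "an [[n₁ + n₂ − k₂, k₁, d]] code")] -/
theorem finrank_genDirectSum (h : IsLogicalBasis S₂ x z) (hS₂ : IsSelfOrthogonal S₂)
    (hk : finrank (ZMod 2) S₂ + k₂ = n₂) :
    finrank (ZMod 2) ↥(genDirectSum S₁ S₂ x z) = finrank (ZMod 2) S₁ + finrank (ZMod 2) S₂ := by
  have hmap : finrank (ZMod 2) ↥(genDirectSum S₁ S₂ x z) = finrank (ZMod 2) ↥(genDirectSumPair S₁ S₂ x z) :=
    (LinearEquiv.finrank_eq (Submodule.equivMapOfInjective _ (juxtEquiv m n₂).injective _)).symm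
  have hsup := Submodule.finrank_sup_add_finrank_inf_eq
    (S₂.map (LinearMap.inr (ZMod 2) (SympVec m) (SympVec n₂))) (S₁.map (liftPair m x z))
  rw [map_inr_inf_map_liftPair h hS₂ hk, finrank_bot, add_zero, ← genDirectSumPair_eq_sup h hS₂ hk,
    ← LinearEquiv.finrank_eq (Submodule.equivMapOfInjective _ LinearMap.inr_injective S₂),
    ← LinearEquiv.finrank_eq (Submodule.equivMapOfInjective _ (liftPair_injective h) S₁)] at hsup
  rw [hmap, hsup, add_comm]

/-! ### Theorem 8 -/

/-- **CRSS Theorem 8 (generalized direct sum).** If `S̄₁` is an `[[m + k₂, k₁, d₁]]` code and `S̄₂` an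
`[[n₂, k₂, d₂]]` code with logical basis `x z` (`ρ = logicalMap x z`), and `k₁ > 0`, then
`C = {(u|v) : v ∈ S̄₂⊥, (u|ρv) ∈ S̄₁}` is an `[[m + n₂, k₁, d]]` code with `d ≥ min{d₁, (d₁ − k₂) + d₂}`
("If `ρ(v) ≠ 0`, `v` contributes at least `d₂` to the weight of `uv`, but `u` need have weight only `d₁ − k₂`. If
`ρ(v) = 0` …, `wt(u) ≥ d₁`."). Here `d₁ − k₂` is truncated subtraction, so this `d` is `≥` the printed
`min{d₁, d₁ + d₂ − k₂}` (see `AdditiveCodeExists.genDirectSum`). The case `k₁ = 0` is excluded (purity convention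
for `[[n,0,d]]`, see the module docstring).
[cite: CalderbankEtAl1998, §4 Thm. 8 (printed p. 14)] -/
theorem CRSS1998_theorem8 {k₁ d₁ d₂ : ℕ} (h₁ : IsAdditiveCode S₁ k₁ d₁) (h₂ : IsAdditiveCode S₂ k₂ d₂)
    (h : IsLogicalBasis S₂ x z) (hk₁ : 0 < k₁) :
    IsAdditiveCode (genDirectSum S₁ S₂ x z) k₁ (min d₁ (d₁ - k₂ + d₂)) := by
  obtain ⟨hS₁o, hS₁dim, hS₁min, -⟩ := h₁
  obtain ⟨hS₂o, hS₂dim, hS₂min, -⟩ := h₂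
  refine ⟨isSelfOrthogonal_genDirectSum hS₁o h hS₂o hS₂dim, ?_, ?_,
    fun hk0 => absurd hk0 (Nat.pos_iff_ne_zero.1 hk₁)⟩
  · rw [finrank_genDirectSum h hS₂o hS₂dim]; omega
  · intro w hw hwC
    rw [sympDual_genDirectSum h hS₂o hS₂dim, mem_genDirectSum_iff] at hw
    rw [mem_genDirectSum_iff, not_and] at hwC
    obtain ⟨hv, huρ⟩ := hw
    -- `(u|ρv) ∈ S̄₁⊥ ∖ S̄₁`, so `wt u + wt ρv ≥ d₁`, and `wt ρv ≤ k₂`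
    have hd₁ : d₁ ≤ sympWeight ((juxtEquiv m n₂).symm w).1 +
        sympWeight (logicalMap x z ((juxtEquiv m n₂).symm w).2) := by
      rw [← sympWeight_juxt]; exact hS₁min _ huρ (hwC hv)
    have hρk : sympWeight (logicalMap x z ((juxtEquiv m n₂).symm w).2) ≤ k₂ := sympWeight_le _
    rw [← juxt_symm_apply w, sympWeight_juxt]
    by_cases hρ : logicalMap x z ((juxtEquiv m n₂).symm w).2 = 0
    · -- `ρ v = 0`: `(u|0) ∈ S̄₁⊥ ∖ S̄₁`, `wt u ≥ d₁`
      rw [hρ, (sympWeight_eq_zero_iff _).2 rfl, add_zero] at hd₁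
      exact (min_le_left _ _).trans (hd₁.trans (Nat.le_add_right _ _))
    · -- `ρ v ≠ 0`: `v ∈ S̄₂⊥ ∖ S̄₂`, `wt v ≥ d₂`
      have hvS : ((juxtEquiv m n₂).symm w).2 ∉ S₂ := fun hvS =>
        hρ ((logicalMap_eq_zero_iff h hS₂o hS₂dim hv).2 hvS)
      have hd₂ := hS₂min _ hv hvS
      exact (min_le_right _ _).trans (by omega)

/-- **CRSS Theorem 8, existence form (as printed).** `[[n₁, k₁, d₁]]` and `[[n₂, k₂, d₂]]` with `k₂ ≤ n₁` (and
`k₁ > 0`) give an `[[n₁ + n₂ − k₂, k₁, min{d₁, d₁ + d₂ − k₂}]]` code.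
[cite: CalderbankEtAl1998, §4 Thm. 8 (printed p. 14)] -/
theorem AdditiveCodeExists.genDirectSum {n₁ n₂ k₁ k₂ d₁ d₂ : ℕ} (h₁ : AdditiveCodeExists n₁ k₁ d₁)
    (h₂ : AdditiveCodeExists n₂ k₂ d₂) (hkn : k₂ ≤ n₁) (hk₁ : 0 < k₁) :
    AdditiveCodeExists (n₁ + n₂ - k₂) k₁ (min d₁ (d₁ + d₂ - k₂)) := by
  obtain ⟨m, rfl⟩ := Nat.exists_eq_add_of_le' hkn
  obtain ⟨S₁, hS₁⟩ := h₁
  obtain ⟨S₂, hS₂⟩ := h₂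
  obtain ⟨x, z, hxz⟩ := hS₂.exists_isLogicalBasis
  rw [show m + k₂ + n₂ - k₂ = m + n₂ by omega]
  exact ⟨_, (CRSS1998_theorem8 hS₁ hS₂ hxz hk₁).mono (by omega)⟩

end Code

end Literature.InformationTheory.QuantumCodes
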